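import Summits.CriticalPhenomena.Ising3DConformalLimit.Theorems.FKParityRobustnessDefs
import Summits.CriticalPhenomena.Ising3DConformalLimit.Theorems.FKParityRobustnessFarMergingGivesU4
import Summits.CriticalPhenomena.Ising3DConformalLimit.Theorems.GapForcesFarMerging.Negative.LineShapes
import Literature.Probability.LatticeModels.ScalingLimit
import HarnessLib

/-!
# Route `FKParityRobustness`, crux `IndependentStrandsJoin` (stmt-CriticalPhenomena-14625):
# vocabulary of the lines `limit-upgrade-io` / `pinch-to-tetra`, and the limit upgrade (registered sub-goal
# `stub_tetraMergingEventually`)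

Route-posited objects (D-0016 `<Route>Defs`-type file) shared by the registered stubs of the skeleton
`Cruxes/IndependentStrandsJoin/Lines/pinch_to_tetra.lean` (crux strategist p1, 2026-08-17; lead
`prover-line-stmt-CriticalPhenomena-14625-c2-0`) and by the Theorems files that compose them
(`…IndependentStrandsJoinLimitUpgrade`, `…IndependentStrandsJoinPinchToTetraReduction`).  Nothing is
asserted about the posited `Prop`s: each is a HYPOTHESIS of a composition (four of them open statements);
every real-valued definition is a finite expression in the tree's critical correlators `criticalCorr 3 n`
(`Literature/Probability/LatticeModels/IsingThermodynamics.lean`).  The namespace is the skeleton's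
(`…Cruxes.IndependentStrandsJoin.PinchToTetra`), so the registered stub signatures read verbatim over this file.
The one THEOREM here is the limit upgrade `tetraMergingEventually_of_io : LimitExists → TetraMergingIO →
TetraMergingEventually` (a convergent sequence that is `≤ −c` infinitely often is eventually `≤ −c/2`; the
ratio `U₄^crit(l·A)/GG` converges under `LimitExists` because `ρ(1/l)⁴U₄ → U₄(S)(A)` and `ρ(1/l)²⟨σσ⟩ →
S₂ > 0`), re-exported as the registered sub-goal `Theorems.stub_tetraMergingEventually`; it is the remark
(strategist census p1, O1) that the crux's `∀ l`-uniformity is not load-bearing FOR THE ROUTE, whose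
`closes` already consumes the existence of the limit (`MoebiusLimit`).

* `U4crit l`, `GGcrit l`, `R4ratio l` — the critical lattice Ursell function `U₄^crit(l·A)` at the dilated
  tetrahedron `A = tetra` (landed `FKParityRobustnessDefs`), the product `⟨σ_{la₀}σ_{la₁}⟩⟨σ_{la₂}σ_{la₃}⟩`
  of the two sourced-pair correlations, and the tetrahedral merging ratio `R₄(A_l) = −U₄/GG`
  (`= 2·P[the two sourced critical currents merge]` by Aizenman's identity; numerically `→ 0.95`).
* `LimitExists` — existence of a non-degenerate pointwise scaling limit of `criticalCorr 3` (the
  existence + non-degeneracy clauses of the route crux `MoebiusLimit`, item stmt-CriticalPhenomena-1344;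
  registered stub `stub_limitExists`, stated there unfolded).
* `TetraMergingIO` / `TetraMergingEventually` — far merging at the regular tetrahedron along infinitely
  many scales / at all large scales (`U₄^crit(l·A) ≤ −c·GG`).
* `IndependentStrandsJoinPerScale` — the PER-SCALE crux (`∀ l ≥ 1, ∃ c(l) > 0, …`, everything else the
  crux verbatim with its `let`s substituted): the standing disprover's Disproof § A statement, TRUE by
  path forcing + XOR transport (registered stub `stub_perScale`, verbatim this text).
* `U4thin ℓ L`, `Nthin ℓ L`, `thinRatio ℓ L` — Ursell function, Aizenman normalisation and merging ratio of
  the THIN opened-pinch configuration `(0, dn(2^ℓL), L·e₂, up(2^ℓL))` of the sibling crux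
  `GapForcesFarMerging` (route `EnergyNotSigmaSquared`; vocabulary `dn/src/up/Th/cc2` of its landed
  `Theorems/GapForcesFarMerging/Negative/LineShapes.lean`).
* `ThinMergingIO S F` — thin merging along infinitely many scales with the thin shape NAMED (what ENS2's
  scale iteration produces), abstract over a two-point kernel `S` and a four-point functional `F`.
* `OctaveTransfer` — the ONE new statement of the line `pinch-to-tetra` (registered stub
  `stub_octaveTransfer`): `∀ ℓ, ∃ C > 0, ∀ L ≥ 1, thinRatio ℓ L ≤ C · Σ_{j ≤ ℓ} R4ratio (2^j L)` — merging of
  the opened strands within `ℓ+1` octaves is controlled by the tetrahedral merging ratios of those octaves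
  (union bound over octaves + boundary decoupling / fat-shape comparability for sourced critical double
  currents on `ℤ³`; open, core-type; `C` may depend on `ℓ`).

References: M. Aizenman, Comm. Math. Phys. 86 (1982) Prop. 5.3 [AizenmanCMP1982]; M. Aizenman,
H. Duminil-Copin, Ann. of Math. 194 (2021), arXiv:1912.07973 [AizenmanDuminilCopinAnnals2021]; the line
cards `Cruxes/IndependentStrandsJoin/Lines/{limit-upgrade-io,pinch-to-tetra}.md` and the strategist census
`Cruxes/IndependentStrandsJoin/STRATEGY-CENSUS.md` (p1).
-/

noncomputable section

open Filter Topology Finset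
open Literature.Probability.LatticeModels
open Summit.CriticalPhenomena.Ising3DConformalLimit.Cruxes.ParityRobustMerging.PlaquetteXorSurgery (tetra tetra_inj)
open Summit.CriticalPhenomena.Ising3DConformalLimit.FKParityRobustnessFarMergingGivesU4
  (injective_vecCons_pair injective_toLp_intCast latticeApprox_inv_natCast)
open Summit.CriticalPhenomena.Ising3DConformalLimit.Theorems.GapForcesFarMerging.Negative (e₂ cc2 up dn src Th)

namespace Summit.CriticalPhenomena.Ising3DConformalLimit.Cruxes.IndependentStrandsJoin.PinchToTetra

/-! ### The tetrahedral side -/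

/-- The critical lattice Ursell function `U₄^crit(l·A)` at the dilated tetrahedron `l·A`,
`A = tetra = ((−1,−1,−1),(1,1,−1),(1,−1,1),(−1,1,1))`, in the infinite-volume critical state
`criticalCorr 3` of `ℤ³`:  `⟨σσσσ⟩ − (⟨01⟩⟨23⟩ + ⟨02⟩⟨13⟩ + ⟨03⟩⟨12⟩)`. -/
def U4crit (l : ℕ) : ℝ :=
  criticalCorr 3 4 (fun i => (l : ℤ) • tetra i) -
    (criticalCorr 3 2 ![(l : ℤ) • tetra 0, (l : ℤ) • tetra 1] * criticalCorr 3 2 ![(l : ℤ) • tetra 2, (l : ℤ) • tetra 3] +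
      criticalCorr 3 2 ![(l : ℤ) • tetra 0, (l : ℤ) • tetra 2] * criticalCorr 3 2 ![(l : ℤ) • tetra 1, (l : ℤ) • tetra 3] +
      criticalCorr 3 2 ![(l : ℤ) • tetra 0, (l : ℤ) • tetra 3] * criticalCorr 3 2 ![(l : ℤ) • tetra 1, (l : ℤ) • tetra 2])

/-- The product `⟨σ_{la₀}σ_{la₁}⟩⟨σ_{la₂}σ_{la₃}⟩` of the two sourced-pair critical correlations at the
dilated tetrahedron (Aizenman's normalisation of `U₄`). -/
def GGcrit (l : ℕ) : ℝ :=
  criticalCorr 3 2 ![(l : ℤ) • tetra 0, (l : ℤ) • tetra 1] * criticalCorr 3 2 ![(l : ℤ) • tetra 2, (l : ℤ) • tetra 3]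

/-- The tetrahedral merging ratio `R₄(A_t) = −U₄^crit(t·A)/(⟨σσ⟩⟨σσ⟩)`
(`= 2·P[the two sourced critical double currents merge]`, Aizenman 1982; `∈ [0,2]`). -/
def R4ratio (t : ℕ) : ℝ := -U4crit t / GGcrit t

/-- **Hypothesis `LimitExists`.**  Existence of a non-degenerate pointwise scaling limit of the critical
Ising correlators on `ℤ³` with a renormalisation `ρ > 0` on `(0,1]`: the existence + non-degeneracy
clauses of the route crux `MoebiusLimit` (item stmt-CriticalPhenomena-1344), nothing about covariance.
OPEN; owned by the covariance routes.  (Registered stub `stub_limitExists` = this, unfolded.) -/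
def LimitExists : Prop :=
  ∃ (ρ : ℝ → ℝ) (S : CorrFamily 3), (∀ δ ∈ Set.Ioc (0:ℝ) 1, 0 < ρ δ) ∧
    HasPointwiseScalingLimit (criticalCorr 3) ρ S ∧ IsNondegenerateTwoPoint S

/-- **Hypothesis `TetraMergingIO`.**  Far merging at the regular tetrahedron ALONG INFINITELY MANY SCALES:
`∃ c > 0, ∀ L₀, ∃ l ≥ L₀, U₄^crit(l·A) ≤ −c·⟨σσ⟩⟨σσ⟩`.  Implied by the crux (at every scale); open. -/
def TetraMergingIO : Prop :=
  ∃ c : ℝ, 0 < c ∧ ∀ L₀ : ℕ, ∃ l : ℕ, L₀ ≤ l ∧ U4crit l ≤ -(c * GGcrit l)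

/-- Far merging at the regular tetrahedron at ALL LARGE scales (the intermediate currency of the limit
upgrade: `LimitExists → TetraMergingIO → TetraMergingEventually`). -/
def TetraMergingEventually : Prop :=
  ∃ c : ℝ, 0 < c ∧ ∃ l₁ : ℕ, ∀ l : ℕ, l₁ ≤ l → U4crit l ≤ -(c * GGcrit l)

/-- **The PER-SCALE crux** (`∀ l ≥ 1, ∃ c(l) > 0, ∃ N₀, ∀ N ≥ N₀, …`): the crux `IndependentStrandsJoin` with
`∃ c` moved after `∀ l` and its `let`s substituted (`tetra`, `t = tanh β_c(3)`), everything else verbatim.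
TRUE (Disproof § A of the crux: force an `a₂–a₀–a₃` lattice path into the second strand, XOR transport;
`c(l)` exponentially small) — the crux is exactly the `l`-uniformity of this constant.  Registered stub
`stub_perScale` = this text. -/
def IndependentStrandsJoinPerScale : Prop :=
  ∀ l : ℕ, 1 ≤ l → ∃ c : ℝ, 0 < c ∧ ∃ N₀ : ℕ, ∀ N : ℕ, N₀ ≤ N → ∀ a : Fin 4 → ↥(box 3 N),
    (∀ i, ((a i : Site 3)) = (l : ℤ) • tetra i) →
    c * loopO1PartitionFunction ((zdGraph 3).comap (Subtype.val : ↥(box 3 N) → Site 3))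
        (Real.tanh (criticalBeta 3)) {a 0, a 1} *
      loopO1PartitionFunction ((zdGraph 3).comap (Subtype.val : ↥(box 3 N) → Site 3))
        (Real.tanh (criticalBeta 3)) {a 2, a 3} ≤
    ∑ F₁ ∈ tJoins ((zdGraph 3).comap (Subtype.val : ↥(box 3 N) → Site 3)) Set.univ {a 0, a 1},
      ∑ F₂ ∈ tJoins ((zdGraph 3).comap (Subtype.val : ↥(box 3 N) → Site 3)) Set.univ {a 2, a 3},
        if (SimpleGraph.fromEdgeSet ((↑F₁ : Set (Sym2 ↥(box 3 N))) ∪ ↑F₂)).Reachable (a 0) (a 2)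
        then Real.tanh (criticalBeta 3) ^ (F₁.card + F₂.card) else 0

/-! ### The thin (opened-pinch) side — vocabulary of the sibling crux `GapForcesFarMerging` -/

/-- The critical Ursell function of the THIN opened-pinch configuration `(0, dn(2^ℓL), L·e₂, up(2^ℓL))`
(sources `0`, `L·e₂` at separation `L`; far targets `dn/up` at scale `2^ℓ L`). -/
def U4thin (ℓ L : ℕ) : ℝ :=
  criticalCorr 3 4 ![0, dn (2 ^ ℓ * L), src L, up (2 ^ ℓ * L)] -
    (cc2 0 (dn (2 ^ ℓ * L)) * cc2 (src L) (up (2 ^ ℓ * L)) +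
      cc2 0 (src L) * cc2 (dn (2 ^ ℓ * L)) (up (2 ^ ℓ * L)) +
      cc2 0 (up (2 ^ ℓ * L)) * cc2 (dn (2 ^ ℓ * L)) (src L))

/-- The Aizenman normalisation `⟨σ₀σ_{dn}⟩⟨σ_{Le₂}σ_{up}⟩` of the thin configuration. -/
def Nthin (ℓ L : ℕ) : ℝ := cc2 0 (dn (2 ^ ℓ * L)) * cc2 (src L) (up (2 ^ ℓ * L))

/-- The thin merging ratio `−U₄(thin)/N` (`= 2·P[the opened strands merge before scale 2^ℓ L]`). -/
def thinRatio (ℓ L : ℕ) : ℝ := -U4thin ℓ L / Nthin ℓ L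

/-- **Thin merging along infinitely many scales, with the thin shape NAMED**: for some passage length
`ℓ ≥ 1`, along infinitely many `L`, the opened configuration `L·Th(2^ℓ)` merges in Aizenman's sense with
constant `1/2` (`F − (SS + SS + SS) ≤ −½·SS`).  Abstract over a pair kernel `S` and a four-point
functional `F`; ENS2's scale iteration proves it for `(cc2, criticalCorr 3 4)` from the single-pinch law,
strict single-pinch positivity and pinched transparency. -/
def ThinMergingIO (S : Site 3 → Site 3 → ℝ) (F : (Fin 4 → Site 3) → ℝ) : Prop :=
  ∃ ℓ : ℕ, 1 ≤ ℓ ∧ ∀ L₀ : ℕ, ∃ L : ℕ, L₀ ≤ L ∧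
    F (fun i => (L : ℤ) • Th (2 ^ ℓ) i) -
        (S ((L : ℤ) • Th (2 ^ ℓ) 0) ((L : ℤ) • Th (2 ^ ℓ) 1) * S ((L : ℤ) • Th (2 ^ ℓ) 2) ((L : ℤ) • Th (2 ^ ℓ) 3) +
          S ((L : ℤ) • Th (2 ^ ℓ) 0) ((L : ℤ) • Th (2 ^ ℓ) 2) * S ((L : ℤ) • Th (2 ^ ℓ) 1) ((L : ℤ) • Th (2 ^ ℓ) 3) +
          S ((L : ℤ) • Th (2 ^ ℓ) 0) ((L : ℤ) • Th (2 ^ ℓ) 3) * S ((L : ℤ) • Th (2 ^ ℓ) 1) ((L : ℤ) • Th (2 ^ ℓ) 2))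
      ≤ -(1 / 2 * (S ((L : ℤ) • Th (2 ^ ℓ) 0) ((L : ℤ) • Th (2 ^ ℓ) 1) * S ((L : ℤ) • Th (2 ^ ℓ) 2) ((L : ℤ) • Th (2 ^ ℓ) 3)))

/-- **Hypothesis `OctaveTransfer`** (the ONE new statement of the line `pinch-to-tetra`; registered stub
`stub_octaveTransfer`; open, core-type).  Merging of the opened strands (separation `L`) before scale
`2^ℓ L` is controlled by the tetrahedral merging ratios of the `ℓ+1` octaves it crosses:
`∀ ℓ, ∃ C > 0, ∀ L ≥ 1, thinRatio ℓ L ≤ C · Σ_{j ≤ ℓ} R4ratio (2^j L)`.  In the true world both sides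
are `Θ(1)`; the content is in the counterfactual regime `R₄(A_t) → 0`. -/
def OctaveTransfer : Prop :=
  ∀ ℓ : ℕ, ∃ C : ℝ, 0 < C ∧ ∀ L : ℕ, 1 ≤ L →
    thinRatio ℓ L ≤ C * ∑ j ∈ Finset.range (ℓ + 1), R4ratio (2 ^ j * L)


/-! ## Step 1 — the limit upgrade: infinitely often ⇒ eventually, under existence of the limit -/

/-- If `f → a` and `f ≤ 0` frequently, then `a ≤ 0`. [folklore] -/
theorem le_zero_of_tendsto_of_frequently {f : ℕ → ℝ} {a : ℝ} (hf : Tendsto f atTop (𝓝 a))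
    (hfr : ∃ᶠ n in atTop, f n ≤ 0) : a ≤ 0 := by
  by_contra h
  push Not at h
  have hev : ∀ᶠ n in atTop, 0 < f n := hf.eventually (lt_mem_nhds h)
  obtain ⟨n, hn1, hn2⟩ := (hfr.and_eventually hev).exists
  exact absurd hn2 (not_lt.2 hn1)

/-- **Limit upgrade.**  Under existence of a non-degenerate pointwise scaling limit, far merging at
the tetrahedron along infinitely many scales holds at ALL large scales (with half the constant):
the ratio `U₄^crit(l·A)/⟨σσ⟩⟨σσ⟩` converges. [folklore] -/
theorem tetraMergingEventually_of_io (hL : LimitExists) (hio : TetraMergingIO) : TetraMergingEventually := by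
  obtain ⟨ρ, S, hρ, hlim, hnd⟩ := hL
  obtain ⟨c, hc, hio⟩ := hio
  -- the continuum configuration `y = A ⊂ ℝ³`, meshes `δ_l = 1/l`
  set y : Fin 4 → EuclideanSpace ℝ (Fin 3) := fun i => WithLp.toLp 2 fun k => ((tetra i k : ℤ) : ℝ) with hy_def
  have hy : Function.Injective y := injective_toLp_intCast tetra_inj
  set δ : ℕ → ℝ := fun l => ((l : ℝ))⁻¹ with hδ_def
  have hδ : Tendsto δ atTop (𝓝[>] (0 : ℝ)) :=
    tendsto_inv_atTop_nhdsGT_zero.comp tendsto_natCast_atTop_atTop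
  have hz : ∀ (l : ℕ) (i : Fin 4), latticeApprox (δ l) (y i) = (l : ℤ) • tetra i :=
    fun l i => latticeApprox_inv_natCast (tetra i) l
  -- convergence of the rescaled four-point and two-point correlators along ALL scales
  have h4 : Tendsto (fun l : ℕ => ρ (δ l) ^ 4 * criticalCorr 3 4 (fun i => (l : ℤ) • tetra i)) atTop
      (𝓝 (S 4 y)) := by
    have hy' : y ∈ NonCoincident 3 4 := hy
    refine (((hlim 4).tendsto_at hy').comp hδ).congr fun l => ?_
    have hzl : (fun i => latticeApprox (δ l) (y i)) = fun i => (l : ℤ) • tetra i := funext (hz l)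
    simp only [Function.comp_apply, rescaledCorrelator_apply, hzl]
  have h2 : ∀ a b : Fin 4, a ≠ b →
      Tendsto (fun l : ℕ => ρ (δ l) ^ 2 * criticalCorr 3 2 ![(l : ℤ) • tetra a, (l : ℤ) • tetra b]) atTop
        (𝓝 (S 2 ![y a, y b])) := by
    intro a b hab
    have hmem : ![y a, y b] ∈ NonCoincident 3 2 := injective_vecCons_pair (hy.ne hab)
    refine (((hlim 2).tendsto_at hmem).comp hδ).congr fun l => ?_
    have hzl : (fun i => latticeApprox (δ l) (![y a, y b] i)) = ![(l : ℤ) • tetra a, (l : ℤ) • tetra b] := by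
      funext i
      fin_cases i <;> simp [hz]
    simp only [Function.comp_apply, rescaledCorrelator_apply, hzl]
  -- the rescaled Ursell function and the rescaled product of pair correlations converge
  set A : ℝ := limitConnectedFour S y with hA
  set B : ℝ := S 2 ![y 0, y 1] * S 2 ![y 2, y 3] with hB
  have hBpos : 0 < B :=
    mul_pos (hnd _ (injective_vecCons_pair (hy.ne (by decide))))
      (hnd _ (injective_vecCons_pair (hy.ne (by decide))))
  have hU : Tendsto (fun l : ℕ => ρ (δ l) ^ 4 * U4crit l) atTop (𝓝 A) := by
    have h := h4.sub ((((h2 0 1 (by decide)).mul (h2 2 3 (by decide))).add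
      ((h2 0 2 (by decide)).mul (h2 1 3 (by decide)))).add
      ((h2 0 3 (by decide)).mul (h2 1 2 (by decide))))
    refine h.congr fun l => ?_
    simp only [U4crit]
    ring
  have hG : Tendsto (fun l : ℕ => ρ (δ l) ^ 4 * GGcrit l) atTop (𝓝 B) := by
    have h := (h2 0 1 (by decide)).mul (h2 2 3 (by decide))
    refine h.congr fun l => ?_
    simp only [GGcrit]
    ring
  -- the io hypothesis, rescaled: frequently `ρ⁴(U₄ + c·GG) ≤ 0`, hence `A + c·B ≤ 0`
  have hfreq : ∃ᶠ l in atTop, ρ (δ l) ^ 4 * U4crit l + c * (ρ (δ l) ^ 4 * GGcrit l) ≤ 0 := by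
    refine Filter.frequently_atTop.2 fun L₀ => ?_
    obtain ⟨l, hl, hle⟩ := hio L₀
    refine ⟨l, hl, ?_⟩
    have hρ4 : 0 ≤ ρ (δ l) ^ 4 := by positivity
    have h0 : U4crit l + c * GGcrit l ≤ 0 := by linarith
    have e : ρ (δ l) ^ 4 * U4crit l + c * (ρ (δ l) ^ 4 * GGcrit l) = ρ (δ l) ^ 4 * (U4crit l + c * GGcrit l) := by
      ring
    rw [e]
    exact mul_nonpos_of_nonneg_of_nonpos hρ4 h0
  have hAB : A + c * B ≤ 0 :=
    le_zero_of_tendsto_of_frequently (hU.add (hG.const_mul c)) hfreq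
  -- hence `A + (c/2)·B < 0`, so eventually `ρ⁴(U₄ + (c/2)·GG) < 0`
  have hneg : A + c / 2 * B < 0 := by nlinarith
  have hev : ∀ᶠ l in atTop, ρ (δ l) ^ 4 * U4crit l + c / 2 * (ρ (δ l) ^ 4 * GGcrit l) < 0 :=
    (hU.add (hG.const_mul (c / 2))).eventually (gt_mem_nhds hneg)
  obtain ⟨l₁, hl₁⟩ := Filter.eventually_atTop.1 (hev.and (Filter.eventually_ge_atTop 1))
  refine ⟨c / 2, by positivity, l₁, fun l hl => ?_⟩
  obtain ⟨hlt, hl1⟩ := hl₁ l hl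
  -- un-rescale: `ρ(1/l) > 0` for `l ≥ 1`
  have hδmem : δ l ∈ Set.Ioc (0:ℝ) 1 := by
    have hl0 : (1 : ℝ) ≤ l := by exact_mod_cast hl1
    refine ⟨by positivity, ?_⟩
    exact inv_le_one_of_one_le₀ hl0
  have hρpos : 0 < ρ (δ l) ^ 4 := pow_pos (hρ _ hδmem) 4
  have key : ρ (δ l) ^ 4 * (U4crit l + c / 2 * GGcrit l) < 0 := by
    have e : ρ (δ l) ^ 4 * (U4crit l + c / 2 * GGcrit l) =
        ρ (δ l) ^ 4 * U4crit l + c / 2 * (ρ (δ l) ^ 4 * GGcrit l) := by ring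
    rw [e]
    exact hlt
  have : U4crit l + c / 2 * GGcrit l < 0 := by
    by_contra hcon
    push Not at hcon
    exact absurd (mul_nonneg hρpos.le hcon) (not_le.2 key)
  linarith

end Summit.CriticalPhenomena.Ising3DConformalLimit.Cruxes.IndependentStrandsJoin.PinchToTetra

/-! ### The registered sub-goal `stub_tetraMergingEventually` -/

namespace Summit.CriticalPhenomena.Ising3DConformalLimit.Theorems

open Summit.CriticalPhenomena.Ising3DConformalLimit.Cruxes.IndependentStrandsJoin.PinchToTetra

/-- **Registered sub-goal `stub_tetraMergingEventually` of the crux `IndependentStrandsJoin`** (stmt-CriticalPhenomena-14625,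
lines `limit-upgrade-io` / `pinch-to-tetra`): under existence of a non-degenerate pointwise scaling limit,
tetrahedral far merging along infinitely many scales holds at all large scales
(`PinchToTetra.tetraMergingEventually_of_io`). -/
theorem stub_tetraMergingEventually : LimitExists → TetraMergingIO → TetraMergingEventually :=
  tetraMergingEventually_of_io

end Summit.CriticalPhenomena.Ising3DConformalLimit.Theorems

end
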